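import Summits.QuantumAdvantage.QuantumAdvantage.Theorems.CubicForrelationNearExactIsExactTwelvePartnerLight
import Summits.QuantumAdvantage.QuantumAdvantage.Theorems.CubicForrelationNearExactIsExactCubicFormR2PartnerLevelTables
import Summits.QuantumAdvantage.QuantumAdvantage.Theorems.CubicForrelationNearExactIsExactCubicFormR2PartnerWlog
import Summits.QuantumAdvantage.QuantumAdvantage.Theorems.CubicForrelationNearExactIsExactCubicFormR2LevelTwoCells
import Summits.QuantumAdvantage.QuantumAdvantage.Theorems.CubicForrelationNearExactIsExactCubicFormLightStructureMu2
import Summits.QuantumAdvantage.QuantumAdvantage.Theorems.CubicForrelationNearExactIsExactCubicFormLightRows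
import Summits.QuantumAdvantage.QuantumAdvantage.Theorems.CubicForrelationNearExactIsExactTwelvePartnerR2LeafW4a
import Summits.QuantumAdvantage.QuantumAdvantage.Theorems.CubicForrelationNearExactIsExactTwelvePartnerR2LeafW4b
import Summits.QuantumAdvantage.QuantumAdvantage.Theorems.CubicForrelationNearExactIsExactCubicFormR2LevelTwoOrdered

/-!
SPLIT (cert seat g43, for the 400-line rule): this is PART 2 — `tpw_R2_level_two` from the ordered form of …CubicFormR2LevelTwoOrdered (part 1).
# Crux `CubicForrelation.NearExactIsExact` (stmt-QuantumAdvantage-14043) — E1280-even, R2 branch: LEVEL `h = 2` (descendant `s₀ω₄`,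
  light cell of weight `96`) END-TO-END — the LAST R2 endgame

Certificate seat `b2b-cforr-cert` (gen 42).  HONEST FRAMING: kernel-checked assembly (standard axioms) of the `s₀ω₄` endgame (R2-PARTNER §4(ω₄),
E1280-HANDPROOFS §1.5–1.6, cell lemma L2 with `μ = 2`).  Light cell `C₀₀` of weight `96` with cubic form `s₀∧ω₄` in normal coordinates
(hypothesis `H2` of …CubicFormR2LowAssembly); WLOG `w(C₁₀) ≤ w(C₀₁)` (swap `y₁ ↔ y₂`, `tpw_R2_yframe_transport`); every cell weighs `≥ 96`
(`tl2_cell_eight_lb`).  If BOTH neighbours weigh `< 160`, `tls_light_structure_mu2` (part 2) makes both mixed slices `ε·ω₄ ⊕ D` with `D ≡ 0`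
or rank 2 supported on `P` — either way the `F′`-rows of `G` and `Γ` are `[s = z₀]·g`, and the leaf `tpa_R2_w4b` (rank count) ends it.  Else
`w(C₀₁) ≥ 160` forces `w(C₁₀) < 128`, the exact-neighbour lemma `tpw_light_structure_mu2_lt128` makes `G|_H = ε·ω₄` pure, `tls_light_structure_mu2`
(part 1, `w(C₀₁) < 192`) gives `Γ|_H = ε'·ω₄ ⊕ D′` with `D′ ≡ 0` or `m∧m′`, and the leaf `tpa_R2_w4a` (dual bases) ends it.  It discharges
`H2` of `theta_twelve_eq_57_64_of_two`.  NOT summit progress.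

* `tpw_R2_level_two_ordered`, `tpw_R2_level_two` (`H2`).
-/

set_option linter.dupNamespace false -- D-0017: single-problem summit ⇒ `QuantumAdvantage.QuantumAdvantage` by design

namespace Summit.QuantumAdvantage.QuantumAdvantage.Theorems.CubicForrelation.NearExactIsExact

open Finset
open Literature.Computability.QuantumComplexity
open Literature.Computability.QuantumComplexity.BuzetChailloux (bxor zeroVec bxor_comm bxor_self bxor_zeroVec zeroVec_bxor
  bxor_bxor_cancel_left)

/-- **Level `h = 2` (`s₀ω₄`) of the R2 branch, light cell `C₀₀`** — the hypothesis `H2` of `theta_twelve_eq_57_64_of_two`. [this work] -/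
theorem tpw_R2_level_two :
    ∀ (hk : 1 + 2 + 2 ≤ 9), 1 ≤ 2 →
    ∀ (κ : (Fin (3 + 9) → Bool) → Bool), IsDegLeFun 3 κ →
    ∀ (c d : Fin (3 + 9) → Fin (3 + 9) → Fin (3 + 9) → ZMod 2),
    (∀ p j k, c p k j = c p j k) → (∀ p j k, c j p k = c p j k) → (∀ p j, c p j j = 0) →
    (∀ φ j k, d φ k j = d φ j k) → (∀ φ j k, d j φ k = d φ j k) → (∀ φ j, d φ j j = 0) →
    (∀ φ j k, d φ j k =
      if ((((κ zeroVec ^^ κ (bxor zeroVec (fun l => decide (l = k)))) ^^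
              (κ (bxor zeroVec (fun l => decide (l = j))) ^^ κ (bxor (bxor zeroVec (fun l => decide (l = j))) (fun l => decide (l = k))))) ^^
            ((κ (bxor zeroVec (fun l => decide (l = φ))) ^^ κ (bxor (bxor zeroVec (fun l => decide (l = φ))) (fun l => decide (l = k)))) ^^
              (κ (bxor (bxor zeroVec (fun l => decide (l = φ))) (fun l => decide (l = j))) ^^
                κ (bxor (bxor (bxor zeroVec (fun l => decide (l = φ))) (fun l => decide (l = j))) (fun l => decide (l = k))))))) = true
      then 1 else 0) →
    (∀ p φ, (∑ j, ∑ k, (if j < k then c p j k * d φ j k else 0)) = if p = φ then 1 else 0) →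
    (∀ y, (κ y ^^ κ (bxor y (fun l => decide (l = Fin.castAdd 9 (0 : Fin 3))))) =
      (y (Fin.castAdd 9 (1 : Fin 3)) && y (Fin.castAdd 9 (2 : Fin 3)))) →
    (∀ j k, d (Fin.castAdd 9 0) j k =
      if (j = Fin.castAdd 9 1 ∧ k = Fin.castAdd 9 2) ∨ (j = Fin.castAdd 9 2 ∧ k = Fin.castAdd 9 1) then 1 else 0) →
    #(univ.filter fun s : Fin 9 → Bool => κ (Fin.append ![false, false, false] s) = true) +
      #(univ.filter fun s : Fin 9 → Bool => κ (Fin.append ![false, false, true] s) = true) +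
      #(univ.filter fun s : Fin 9 → Bool => κ (Fin.append ![false, true, false] s) = true) < 384 →
    ∀ (i j : Bool), (i && j) = false →
    (∀ i' j' : Bool, (i' && j') = false →
      #(univ.filter fun s : Fin 9 → Bool => κ (Fin.append ![false, i, j] s) = true) ≤
        #(univ.filter fun s : Fin 9 → Bool => κ (Fin.append ![false, i', j'] s) = true)) →
    0 < #(univ.filter fun s : Fin 9 → Bool => κ (Fin.append ![false, i, j] s) = true) →
    4 * #(univ.filter fun s : Fin 9 → Bool => κ (Fin.append ![false, i, j] s) = true) + 2 ^ (9 - 2) = 2 ^ 9 →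
    ∀ (bz : Bool), (∀ s : Fin 9 → Bool, κ (Fin.append ![false, i, j] s) = true → s (Fin.castLE hk (Fin.castAdd 2 (Fin.castAdd 2 (0 : Fin 1)))) = bz) →
    (∀ u v w x : Fin 9 → Bool,
      ((((κ (Fin.append ![false, i, j] x) ^^ κ (Fin.append ![false, i, j] (bxor x w))) ^^
              (κ (Fin.append ![false, i, j] (bxor x v)) ^^ κ (Fin.append ![false, i, j] (bxor (bxor x v) w)))) ^^
            ((κ (Fin.append ![false, i, j] (bxor x u)) ^^ κ (Fin.append ![false, i, j] (bxor (bxor x u) w))) ^^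
              (κ (Fin.append ![false, i, j] (bxor (bxor x u) v)) ^^
                κ (Fin.append ![false, i, j] (bxor (bxor (bxor x u) v) w)))))) =
      ((((u (Fin.castLE hk (Fin.castAdd 2 (Fin.castAdd 2 (0 : Fin 1)))) &&
            decide ((∑ ii : Fin 2, ((if v (Fin.castLE hk (Fin.castAdd 2 (Fin.natAdd 1 ii))) = true then (1 : ZMod 2) else 0) * (if w (Fin.castLE hk (Fin.natAdd (1 + 2) ii)) = true then (1 : ZMod 2) else 0) +
              (if v (Fin.castLE hk (Fin.natAdd (1 + 2) ii)) = true then (1 : ZMod 2) else 0) * (if w (Fin.castLE hk (Fin.castAdd 2 (Fin.natAdd 1 ii))) = true then (1 : ZMod 2) else 0))) = 1)) ^^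
          (v (Fin.castLE hk (Fin.castAdd 2 (Fin.castAdd 2 (0 : Fin 1)))) &&
            decide ((∑ ii : Fin 2, ((if u (Fin.castLE hk (Fin.castAdd 2 (Fin.natAdd 1 ii))) = true then (1 : ZMod 2) else 0) * (if w (Fin.castLE hk (Fin.natAdd (1 + 2) ii)) = true then (1 : ZMod 2) else 0) +
              (if u (Fin.castLE hk (Fin.natAdd (1 + 2) ii)) = true then (1 : ZMod 2) else 0) * (if w (Fin.castLE hk (Fin.castAdd 2 (Fin.natAdd 1 ii))) = true then (1 : ZMod 2) else 0))) = 1))) ^^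
          (w (Fin.castLE hk (Fin.castAdd 2 (Fin.castAdd 2 (0 : Fin 1)))) &&
            decide ((∑ ii : Fin 2, ((if u (Fin.castLE hk (Fin.castAdd 2 (Fin.natAdd 1 ii))) = true then (1 : ZMod 2) else 0) * (if v (Fin.castLE hk (Fin.natAdd (1 + 2) ii)) = true then (1 : ZMod 2) else 0) +
              (if u (Fin.castLE hk (Fin.natAdd (1 + 2) ii)) = true then (1 : ZMod 2) else 0) * (if v (Fin.castLE hk (Fin.castAdd 2 (Fin.natAdd 1 ii))) = true then (1 : ZMod 2) else 0))) = 1))))) → i = false → j = false → False := by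
  intro hk _ κ hκ c d hcs hcc hcd hds hdc hdd hd hpair hD0 hF1 hsum i j _ _ _ hwt bz hsupp hT hi0 hj0
  subst hi0; subst hj0
  by_cases hle : #(univ.filter fun s : Fin 9 → Bool => κ (Fin.append ![false, true, false] s) = true) ≤
      #(univ.filter fun s : Fin 9 → Bool => κ (Fin.append ![false, false, true] s) = true)
  · exact tpw_R2_level_two_ordered hk κ hκ c d hcs hcc hcd hds hdc hdd hd hpair hD0 hF1 hsum hwt bz hsupp hT hle
  · obtain ⟨κ', c', d', hκ'3, hcs', hcc', hcd', hd'T, hpair', hD0', hF1', hcell⟩ :=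
      tpw_R2_yframe_transport κ hκ c d hcs hcc hcd hds hdd hd hpair hD0
        (fun t t' => if (t = 0 ∧ t' = 0) ∨ (t = 1 ∧ t' = 2) ∨ (t = 2 ∧ t' = 1) then 1 else 0)
        (fun t t' => if (t = 0 ∧ t' = 0) ∨ (t = 1 ∧ t' = 2) ∨ (t = 2 ∧ t' = 1) then 1 else 0)
        (by decide) (by decide) ![false, false, false] (by decide) (by decide)
    obtain ⟨hds', hdc', hdd''⟩ := tpw_d_symm κ' d' hd'T
    have h00 : ∀ s, κ' (Fin.append ![false, false, false] s) = κ (Fin.append ![false, false, false] s) := fun s => by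
      rw [hcell]; congr 2; decide
    have h01 : ∀ s, κ' (Fin.append ![false, false, true] s) = κ (Fin.append ![false, true, false] s) := fun s => by
      rw [hcell]; congr 2; decide
    have h10 : ∀ s, κ' (Fin.append ![false, true, false] s) = κ (Fin.append ![false, false, true] s) := fun s => by
      rw [hcell]; congr 2; decide
    refine tpw_R2_level_two_ordered hk κ' hκ'3 c' d' hcs' hcc' hcd' hds' hdc' hdd'' hd'T hpair' hD0' hF1' ?_ ?_ bz ?_ ?_ ?_
    · simp only [h00, h01, h10]; omega
    · simp only [h00]; exact hwt
    · intro s hs; rw [h00] at hs; exact hsupp s hs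
    · intro u v w x; simp only [h00]; exact hT u v w x
    · simp only [h01, h10]; omega

end Summit.QuantumAdvantage.QuantumAdvantage.Theorems.CubicForrelation.NearExactIsExact
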